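import Literature.AlgebraicGeometry.Resolution.QuadraticTransforms
import Mathlib.RingTheory.Ideal.Span
import Mathlib.Algebra.CharP.Two
import HarnessLib

/-!
# Crux `Steer` (stmt-ResolutionOfSingularities-16345), chain W4.1, hARᵒ slot S1a (res-L0-w41-tri-1 MEMBER-DATUM words `v614/MemberDatum.lean`
# c53f80ab1efd935a, target `VisitLawAt`): **ring-level bricks of the visit law — the exceptional parameter along a principal centre, and the
# strip law with its cleaned-order-along-`x` bookkeeping** (FILE 1 of res-type-096's staged plan, plan-1 RULING 132a)

OURS (campaign `res-hironaka`, rung L ★L-G4, slot W4.1; seat res-type-096 g9; replaces the role of no printed item; NOT a statement of the manuscript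
under review [claim: Hironaka2017, status: under-review]; AI-produced, weaker than expert review). Theses-free and definition-free. The member-
constancy brick (i) «a local blowing up along a PRINCIPAL centre returns the member» is res-type-082's tree theorem
`NoSingularCarrier.eq_of_isLocalBlowupAlong_span_singleton` (not re-proved here).

* `exists_isUnit_mul_eq_of_excParam_span_singleton` — (ii) along a principal centre `(u)` of a member `R ⊆ K` dominated by `O`, an
  exceptional parameter `x` (`x ∈ (u)`, `x ≠ 0`, of maximal `O`-value on `(u)` — `IsExcParamAlong` unfolded) is `u` times a UNIT of `R`.
* `sq_strip_identity` — (iii) in characteristic `2`: `s = x·s' + g` ⇒ `s² − (g + x·γ)² = x²·(s'² − γ²)` for every `γ` (the cleaner dictionary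
  `g ↔ g + xγ` between a member and its strip / point-step transform).
* `sub_sq_mem_span_pow_add_two` — hence `f' − γ² ∈ (x^k) ⇒ f − (g + xγ)² ∈ (x^(k+2))` when `f − g² = x²·f'`;
  `exists_cleaner_of_sub_sq_mem_span_pow_add_two` — conversely, for `x` PRIME in a domain, `f − g₂² ∈ (x^(k+2))` ⇒ `g₂ = g + xγ` with
  `f' − γ² ∈ (x^k)`: the cleaned order ALONG `x` drops by EXACTLY `2` under a strip (`HasClordAlongAt … x (k+2)` at the member ⟺
  `HasClordAlongAt … x k` at the transform, same ring), the parity of the `x`-order is preserved — tri-1's D·S3 strip bookkeeping.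

[folklore]
-/

noncomputable section

-- `Summit.<S>.<S>.…` duplicates the summit name by design (single-problem summit).
set_option linter.dupNamespace false

open IsLocalRing

namespace Summit.ResolutionOfSingularities.ResolutionOfSingularities.Theorems.SwitchingDichotomy

open Literature.AlgebraicGeometry.Resolution

namespace VisitLaw

/-! ## (ii) The exceptional parameter along a principal centre -/

variable {K : Type} [Field K]

/-- **Along a principal centre `(u)`, an exceptional parameter is `u` up to a unit of the member**: if `R ⊆ K` is dominated by the valuation
ring `O`, `x ∈ (u)` is non-zero and has maximal `O`-value on `(u)` (`IsExcParamAlong O R (span {u}) x` unfolded), then `x = r·u` with `r` a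
unit of `R` (`v(x) = v(r)·v(u) ≤ v(u) ≤ v(x)` forces `v(r) = 1`, and `O` dominates `R`). OURS. [folklore] -/
theorem exists_isUnit_mul_eq_of_excParam_span_singleton {O : ValuationSubring K} {R : Subring K}
    (hRO : SubringDominates R O.toSubring) (u : R) {x : K} (hxR : x ∈ R)
    (hxP : (⟨x, hxR⟩ : R) ∈ Ideal.span {u}) (hx0 : x ≠ 0)
    (hxmax : ∀ y : R, y ∈ Ideal.span {u} → O.valuation (y : K) ≤ O.valuation x) :
    ∃ r : R, IsUnit r ∧ x = (r : K) * (u : K) := by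
  obtain ⟨r, hr⟩ := Ideal.mem_span_singleton'.mp hxP
  have hxru : x = (r : K) * (u : K) := by
    have := congrArg Subtype.val hr
    simpa using this.symm
  have hu0 : (u : K) ≠ 0 := by
    intro h0; apply hx0; rw [hxru, h0, mul_zero]
  have hr0 : (r : K) ≠ 0 := by
    intro h0; apply hx0; rw [hxru, h0, zero_mul]
  -- `v(u) ≤ v(x) = v(r) v(u)` with `v(r) ≤ 1` ⇒ `v(r) = 1`
  have hvu : O.valuation (u : K) ≤ O.valuation x := hxmax u (Ideal.mem_span_singleton_self u)
  have hvr1 : O.valuation (r : K) ≤ 1 := (O.valuation_le_one_iff _).mpr (hRO.1 r.2)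
  have hvr : O.valuation (r : K) = 1 := by
    have hvu0 : O.valuation (u : K) ≠ 0 := (map_ne_zero _).mpr hu0
    have hxv : O.valuation x = O.valuation (r : K) * O.valuation (u : K) := by rw [hxru, map_mul]
    have h1 : O.valuation (r : K) * O.valuation (u : K) = 1 * O.valuation (u : K) := by
      refine le_antisymm (mul_le_mul' hvr1 le_rfl) ?_
      rw [one_mul, ← hxv]
      exact hvu
    exact mul_right_cancel₀ hvu0 h1
  -- `r` is a unit of `O`, hence of `R`
  have hrinvO : (r : K)⁻¹ ∈ O := by
    rw [← O.valuation_le_one_iff, map_inv₀, hvr, inv_one]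
  have hrinvR : (r : K)⁻¹ ∈ R := hRO.2 _ r.2 hrinvO
  exact ⟨r, (isUnit_subring_iff_inv_mem r).mpr ⟨hr0, hrinvR⟩, hxru⟩

/-! ## (iii) The strip law and the cleaned order along `x` -/

variable {A : Type*} [CommRing A]

/-- **The strip / point-step square identity in characteristic `2`**: `s = x·s' + g` gives `s² − (g + x·γ)² = x²·(s'² − γ²)` for every
`γ`. OURS. [folklore] -/
theorem sq_strip_identity [CharP A 2] (s s' x g γ : A) (hstep : s = x * s' + g) :
    s ^ 2 - (g + x * γ) ^ 2 = x ^ 2 * (s' ^ 2 - γ ^ 2) := by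
  have h2 : (2 : A) = 0 := CharTwo.two_eq_zero
  subst hstep
  linear_combination (x * s' * g - g * x * γ) * h2

/-- **Cleaners lift through a strip**: if `f − g² = x²·f'` and `f' − γ² ∈ (x^k)` then `f − (g + xγ)² ∈ (x^(k+2))` (characteristic `2`).
OURS. [folklore] -/
theorem sub_sq_mem_span_pow_add_two [CharP A 2] {f f' g x γ : A} (hlaw : f - g ^ 2 = x ^ 2 * f') {k : ℕ}
    (hγ : f' - γ ^ 2 ∈ Ideal.span {x ^ k}) : f - (g + x * γ) ^ 2 ∈ Ideal.span {x ^ (k + 2)} := by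
  have h2 : (2 : A) = 0 := CharTwo.two_eq_zero
  obtain ⟨a, ha⟩ := Ideal.mem_span_singleton'.mp hγ
  refine Ideal.mem_span_singleton'.mpr ⟨a, ?_⟩
  have key : f - (g + x * γ) ^ 2 = x ^ 2 * (f' - γ ^ 2) := by
    linear_combination hlaw - (g * x * γ) * h2
  rw [key, ← ha]
  ring

/-- **Cleaners descend through a strip** (`x` prime in a domain): if `f − g² = x²·f'` and `f − g₂² ∈ (x^(k+2))` then `g₂ = g + x·γ` for some
`γ` with `f' − γ² ∈ (x^k)` — so the cleaned order ALONG `x` drops by exactly `2` and keeps its parity. OURS. [folklore] -/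
theorem exists_cleaner_of_sub_sq_mem_span_pow_add_two [IsDomain A] [CharP A 2] {f f' g g₂ x : A} (hx : Prime x)
    (hlaw : f - g ^ 2 = x ^ 2 * f') {k : ℕ} (hg₂ : f - g₂ ^ 2 ∈ Ideal.span {x ^ (k + 2)}) :
    ∃ γ : A, g₂ = g + x * γ ∧ f' - γ ^ 2 ∈ Ideal.span {x ^ k} := by
  have h2 : (2 : A) = 0 := CharTwo.two_eq_zero
  obtain ⟨a, ha⟩ := Ideal.mem_span_singleton'.mp hg₂
  -- `(g₂ − g)² = x²·(f' − a x^k)` ⇒ `x ∣ g₂ − g`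
  have hsq : (g₂ - g) ^ 2 = x ^ 2 * (f' - a * x ^ k) := by
    linear_combination hlaw + ha + (g ^ 2 - g * g₂) * h2
  have hdvd : x ∣ (g₂ - g) ^ 2 := ⟨x * (f' - a * x ^ k), by rw [hsq]; ring⟩
  obtain ⟨γ, hγ⟩ := hx.dvd_of_dvd_pow hdvd
  refine ⟨γ, by rw [← hγ]; ring, Ideal.mem_span_singleton'.mpr ⟨a, ?_⟩⟩
  -- cancel `x²`
  have hx0 : x ^ 2 ≠ 0 := pow_ne_zero 2 hx.ne_zero
  have h3 : x ^ 2 * (a * x ^ k) = x ^ 2 * (f' - γ ^ 2) := by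
    have e1 : (g₂ - g) ^ 2 = x ^ 2 * γ ^ 2 := by rw [hγ]; ring
    linear_combination -(hsq.symm.trans e1)
  have := mul_left_cancel₀ hx0 h3
  linear_combination this

end VisitLaw

end Summit.ResolutionOfSingularities.ResolutionOfSingularities.Theorems.SwitchingDichotomy

end
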